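import Mathlib.FieldTheory.KummerExtension
import Mathlib.RingTheory.RootsOfUnity.Complex
import Mathlib.Analysis.SpecialFunctions.Pow.Complex
import Mathlib.RingTheory.Algebraic.Basic
import Literature.NumberTheory.Transcendental.KZCalculus

/-!
# OffTetraSectorKernel (stmt-KontsevichZagierPeriods-10557), line odd-hyperbolic-ladder: stub stub_kthRootsExist

Pure algebra: for `k ≥ 1` and a non-real complex number `z`, algebraic over `ℚ`, the `k`-th roots of
`z` form a vector `w : Fin k → ℂ` with

* `∏ⱼ (x − wⱼ) = x^k − z` for every `x : ℂ` (Mathlib's `X_pow_sub_C_eq_prod` for the primitive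
  root `ζ = exp (2πi/k)` (`Complex.isPrimitiveRoot_exp`) and `α = z^{1/k}` (`Complex.cpow_nat_inv_pow`),
  evaluated at `x`), namely `wⱼ = ζ^j · α`;
* each `wⱼ` algebraic (`wⱼ^k = z`, `IsAlgebraic.of_pow`);
* each `wⱼ` non-real (a real `w` has real `w^k = z`);
* `‖wⱼ‖^k = ‖z‖` (`norm_pow`).

References: D. Zagier, *The dilogarithm function* (2007), Ch. I §2 (the distribution relation runs
over the `k`-th roots); M. Kontsevich, D. Zagier, *Periods* (2001), §1.2.
-/

noncomputable section

open Set MeasureTheory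
open Literature.NumberTheory.Transcendental
open Polynomial

namespace Summit.KontsevichZagierPeriods.HyperbolicBloch.OffTetraSectorKernel

/-- The powers `(ζ^j α)^k` of the candidate roots all equal `α^k`, for `ζ` a `k`-th root of unity.
[cite: Zagier2007Dilogarithm, Ch. I §2] -/
theorem kthRootsExist_pow_eq {k : ℕ} {ζ α : ℂ} (hζ : ζ ^ k = 1) (j : ℕ) :
    (ζ ^ j * α) ^ k = α ^ k := by
  rw [mul_pow, ← pow_mul, mul_comm j k, pow_mul, hζ, one_pow, one_mul]

/-- A complex number with a non-real `k`-th power is itself non-real.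
[cite: Zagier2007Dilogarithm, Ch. I §2] -/
theorem kthRootsExist_im_ne_zero {k : ℕ} {w z : ℂ} (hw : w ^ k = z) (hz : z.im ≠ 0) :
    w.im ≠ 0 := by
  intro hwim
  apply hz
  have hwre : (w.re : ℂ) = w := Complex.ext (by simp) (by simp [hwim])
  rw [← hw, ← hwre, ← Complex.ofReal_pow, Complex.ofReal_im]

/-- STUB `stub_kthRootsExist` (pure algebra): for `k ≥ 1` and a non-real algebraic `z`, the `k`-th roots of `z` form a
vector `w : Fin k → ℂ` with `∏ⱼ (x − wⱼ) = x^k − z`, each `wⱼ` algebraic (`IsAlgebraic.of_pow`), non-real (a real `w` has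
real `w^k = z`), of modulus `|z|^{1/k}` (`X_pow_sub_C_eq_prod` with `Complex.isPrimitiveRoot_exp` and `α = z^{1/k}`).
[cite: Zagier2007Dilogarithm, Ch. I §2] -/
theorem stub_kthRootsExist :
    ∀ (k : ℕ), 1 ≤ k → ∀ (z : ℂ), IsAlgebraic ℚ z → z.im ≠ 0 →
      ∃ w : Fin k → ℂ, (∀ x : ℂ, ∏ j, (x - w j) = x ^ k - z) ∧ (∀ j, IsAlgebraic ℚ (w j)) ∧
        (∀ j, (w j).im ≠ 0) ∧ (∀ j, ‖w j‖ ^ k = ‖z‖) := by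
  intro k hk z hz hzim
  have hk0 : k ≠ 0 := Nat.one_le_iff_ne_zero.mp hk
  have hkpos : 0 < k := Nat.pos_of_ne_zero hk0
  -- the primitive `k`-th root of unity `ζ = exp (2πi/k)` and the principal root `α = z^{1/k}`
  set ζ : ℂ := Complex.exp (2 * Real.pi * Complex.I / k) with hζdef
  have hζ : IsPrimitiveRoot ζ k := Complex.isPrimitiveRoot_exp k hk0
  set α : ℂ := z ^ ((k : ℂ)⁻¹) with hαdef
  have hα : α ^ k = z := Complex.cpow_nat_inv_pow z hk0
  have hpow : ∀ j : Fin k, (ζ ^ (j : ℕ) * α) ^ k = z := fun j => by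
    rw [kthRootsExist_pow_eq hζ.pow_eq_one, hα]
  refine ⟨fun j => ζ ^ (j : ℕ) * α, ?_, ?_, ?_, ?_⟩
  · -- `∏ⱼ (x − ζ^j α) = x^k − z`: evaluate `X^k − C z = ∏ (X − C (ζ^i α))` at `x`
    intro x
    have h := congrArg (Polynomial.eval x) (X_pow_sub_C_eq_prod hζ hkpos hα)
    simp only [eval_sub, eval_pow, eval_X, eval_C, eval_prod] at h
    rw [h]
    exact Fin.prod_univ_eq_prod_range (fun i => x - ζ ^ i * α) k
  · -- algebraic: `(ζ^j α)^k = z` is algebraic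
    intro j
    exact IsAlgebraic.of_pow hkpos (by rw [hpow j]; exact hz)
  · -- non-real
    intro j
    exact kthRootsExist_im_ne_zero (hpow j) hzim
  · -- modulus
    intro j
    show ‖ζ ^ (j : ℕ) * α‖ ^ k = ‖z‖
    rw [← norm_pow, hpow j]

end Summit.KontsevichZagierPeriods.HyperbolicBloch.OffTetraSectorKernel
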